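import Summits.RiemannHypothesis.RiemannHypothesis.Theorems.SignConeSignConeOscillatoryStubExtremalExistsL2
import Literature.NumberTheory.LFunctions.WeilArchimedeanPositivityProofs

/-!
# Stub `stub_extremalExists` (line `dual_witness`, crux `SignConeOscillatory`, stmt-RiemannHypothesis-16302), II:
# lower semicontinuity of the prime-free Weil form along `L²`-convergent minimising sequences

Setting: a window `a > 0`, test functions `gₙ` with `tsupport gₙ ⊆ [-a, a]`, `∫ |gₙ|² = 1`, and `u ∈ L²` with
`supp u ⊆ [-a, a]` and `∫ |gₙ − u|² → 0`.  We prove (`lsc_package`): `∫ |u|² = 1`; the polar terms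
`M_{Fₙ}(0), M_{Fₙ}(1)` of `Fₙ = gₙ ⋆ g̃ₙ` converge to those of `F = u ⋆ ũ` (dominated convergence: `|Fₙ| ≤ 1` on
`[-2a, 2a]`, `Fₙ → F` pointwise); and if the values `Re W_ar(Fₙ) = reWar Fₙ` converge to `V` then the archimedean
integrand of `F` is integrable and `reWar F ≤ V`.  The last step is Fatou's lemma for the nonnegative functions
`|ĝₙ(1/2+it)|² (ρ(t) − ρ(0))`, `ρ(t) = Re ψ(1/4 + it/2) ≥ ρ(0)`, which converge pointwise to `|û(1/2+it)|² (ρ − ρ(0))`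
(critical-line values are `√(2a)`-Lipschitz in `‖·‖₂` on the window), combined with Plancherel
`∫ |ĝₙ(1/2+it)|² = ∫ |û(1/2+it)|² = 2π`.  This is the "`Q̄(u) ≤ liminf Q(gₙ)`" half of Bombieri's variational
argument (Bombieri 2000, proof of Thm. 3), here for the polar-plus-archimedean form of the sign-cone route.
-/

noncomputable section

-- `Summit.RiemannHypothesis.RiemannHypothesis.…` repeats a namespace component by design (D-0017 layout).
set_option linter.dupNamespace false

open scoped BigOperators ComplexConjugate Topology ENNReal FourierTransform
open MeasureTheory Set Filter Complex

namespace Summit.RiemannHypothesis.RiemannHypothesis.Theorems.SignCone.DualWitness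

open Literature.NumberTheory.LFunctions Literature.Analysis.SpecialFunctions

/-- Shorthand: the `L²` norm as a real number. [folklore] -/
local notation "N₂" u:arg => ENNReal.toReal (eLpNorm u 2 MeasureTheory.MeasureSpace.volume)

variable {a : ℝ} {u : ℝ → ℂ} {g : ℕ → ℝ → ℂ}

/-! ## The real-part bookkeeping of `reWar` -/

/-- `reWar F = Re (M_F(0) + M_F(1)) + (1/2π) Re (weilArchIntegral F) − Re F(0) · log π`. [folklore] -/
theorem reWar_eq_parts (F : ℝ → ℂ) :
    reWar F = (weilMellin F 0 + weilMellin F 1).re + 1 / (2 * Real.pi) * (weilArchIntegral F).re -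
      (F 0).re * Real.log Real.pi := by
  rw [reWar_eq]
  simp only [weilPolarTerm, weilArchTerm, add_re, sub_re, mul_re, ofReal_re, ofReal_im]
  have h1 : ((1 / (2 * Real.pi) : ℂ)).re = 1 / (2 * Real.pi) := by
    rw [show (1 / (2 * Real.pi) : ℂ) = ((1 / (2 * Real.pi) : ℝ) : ℂ) by push_cast; rfl, ofReal_re]
  have h2 : ((1 / (2 * Real.pi) : ℂ)).im = 0 := by
    rw [show (1 / (2 * Real.pi) : ℂ) = ((1 / (2 * Real.pi) : ℝ) : ℂ) by push_cast; rfl, ofReal_im]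
  rw [h1, h2]
  ring

/-- For integrable `u` (any `u`, in fact): `weilArchIntegral (u ⋆ ũ) = ∫ |û(1/2+it)|² ρ(t) dt` as a complex number,
`ρ = reDigammaQuarter`. [folklore] -/
theorem weilArchIntegral_autocorr (hi : Integrable u) :
    weilArchIntegral (autocorr u) =
      ((∫ t : ℝ, ‖weilMellin u (1 / 2 + t * I)‖ ^ 2 * reDigammaQuarter t : ℝ) : ℂ) := by
  unfold weilArchIntegral
  rw [← integral_complex_ofReal]
  congr 1 with t
  rw [weilMellin_autocorr_half hi t]
  unfold reDigammaQuarter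
  push_cast
  ring

/-- Hence `reWar (u ⋆ ũ) = Re (M(0) + M(1)) + (1/2π) ∫ |û|² ρ − Re (u ⋆ ũ)(0) log π`. [folklore] -/
theorem reWar_autocorr_eq (hi : Integrable u) :
    reWar (autocorr u) = (weilMellin (autocorr u) 0 + weilMellin (autocorr u) 1).re +
      1 / (2 * Real.pi) * (∫ t : ℝ, ‖weilMellin u (1 / 2 + t * I)‖ ^ 2 * reDigammaQuarter t) -
      (autocorr u 0).re * Real.log Real.pi := by
  rw [reWar_eq_parts, weilArchIntegral_autocorr hi, ofReal_re]

/-! ## The setting: a normalised window sequence converging in `L²` -/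

/-- **The `L²`-limit of a normalised sequence is normalised**: `∫ |u|² = 1`. [folklore] -/
theorem integral_norm_sq_eq_one_of_tendsto (hg2 : ∀ n, MemLp (g n) 2 volume) (hn : ∀ n, ∫ t, ‖g n t‖ ^ 2 = 1)
    (hu : MemLp u 2 volume) (hlim : Tendsto (fun n => ∫ x, ‖g n x - u x‖ ^ 2) atTop (𝓝 0)) :
    ∫ t, ‖u t‖ ^ 2 = 1 := by
  -- `|√∫|u|² − 1| ≤ √∫|gₙ − u|² → 0`
  have hkey : ∀ n, |Real.sqrt (∫ t, ‖u t‖ ^ 2) - 1| ≤ Real.sqrt (∫ t, ‖g n t - u t‖ ^ 2) := by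
    intro n
    have h1 := sqrt_integral_norm_sq_sub_le hu (hg2 n)   -- √∫|u - gₙ|² ≤ √∫|u|² + √∫|gₙ|²  (not needed)
    have hA := sqrt_integral_norm_sq_sub_le (hu.sub (hu.sub (hg2 n))) (hu.sub (hg2 n))
    -- simpler: triangle inequalities in both directions
    have e1 : Real.sqrt (∫ t, ‖g n t‖ ^ 2) = 1 := by rw [hn n, Real.sqrt_one]
    have hB : Real.sqrt (∫ t, ‖u t‖ ^ 2) ≤ Real.sqrt (∫ t, ‖u t - g n t‖ ^ 2) + 1 := by
      have := sqrt_integral_norm_sq_sub_le (hu.sub (hg2 n)) ((hg2 n).neg)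
      have e : (fun t => (u - g n) t - (-g n) t) = u := by funext t; simp
      have e' : (fun t => ‖(u - g n) t - (-g n) t‖ ^ 2) = fun t => ‖u t‖ ^ 2 := by funext t; simp
      rw [e'] at this
      simpa [e1, norm_neg] using this
    have hC : (1 : ℝ) ≤ Real.sqrt (∫ t, ‖g n t - u t‖ ^ 2) + Real.sqrt (∫ t, ‖u t‖ ^ 2) := by
      have := sqrt_integral_norm_sq_sub_le ((hg2 n).sub hu) hu.neg
      have e' : (fun t => ‖(g n - u) t - (-u) t‖ ^ 2) = fun t => ‖g n t‖ ^ 2 := by funext t; simp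
      rw [e'] at this
      simpa [e1, norm_neg] using this
    have hsym : Real.sqrt (∫ t, ‖u t - g n t‖ ^ 2) = Real.sqrt (∫ t, ‖g n t - u t‖ ^ 2) := by
      congr 1; refine integral_congr_ae (Eventually.of_forall fun t => ?_); simp [norm_sub_rev]
    rw [hsym] at hB
    rw [abs_le]; constructor <;> linarith
  have hlim' : Tendsto (fun n => Real.sqrt (∫ t, ‖g n t - u t‖ ^ 2)) atTop (𝓝 0) := by
    have h := (Real.continuous_sqrt.tendsto 0).comp hlim
    rw [Real.sqrt_zero] at h; exact h
  have h0 : |Real.sqrt (∫ t, ‖u t‖ ^ 2) - 1| = 0 :=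
    le_antisymm (ge_of_tendsto' hlim' hkey) (abs_nonneg _)
  have h1 : Real.sqrt (∫ t, ‖u t‖ ^ 2) = 1 := by linarith [abs_eq_zero.mp h0]
  have hnn : 0 ≤ ∫ t, ‖u t‖ ^ 2 := integral_nonneg fun _ => by positivity
  nlinarith [Real.sq_sqrt hnn, Real.sqrt_nonneg (∫ t, ‖u t‖ ^ 2)]

section Setting

variable (ha : 0 < a) (hg : ∀ n, IsWeilTest (g n) ∧ tsupport (g n) ⊆ Icc (-a) a ∧ ∫ t, ‖g n t‖ ^ 2 = 1)
  (hu : MemLp u 2 volume) (hsu : Function.support u ⊆ Icc (-a) a)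
  (hlim : Tendsto (fun n => ∫ x, ‖g n x - u x‖ ^ 2) atTop (𝓝 0))

include hg in
/-- Tests are `L²`. [folklore] -/
theorem memLp_two_of_test (n : ℕ) : MemLp (g n) 2 volume :=
  (hg n).1.1.continuous.memLp_of_hasCompactSupport (hg n).1.2

include hg in
/-- `supp gₙ ⊆ [-a, a]`. [folklore] -/
theorem support_subset_of_test (n : ℕ) : Function.support (g n) ⊆ Icc (-a) a :=
  (subset_tsupport _).trans (hg n).2.1

include hg in
/-- `‖gₙ‖₂ = 1`. [folklore] -/
theorem toReal_eLpNorm_eq_one (n : ℕ) : N₂ (g n) = 1 := by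
  rw [toReal_eLpNorm_two_eq_sqrt (memLp_two_of_test hg n), (hg n).2.2, Real.sqrt_one]

include hg in
/-- `|Fₙ(x)| ≤ 1`, `Fₙ = gₙ ⋆ g̃ₙ`. [folklore] -/
theorem norm_autocorr_test_le_one (n : ℕ) (x : ℝ) : ‖autocorr (g n) x‖ ≤ 1 := by
  have h := norm_autocorr_le (memLp_two_of_test hg n) x
  rwa [toReal_eLpNorm_eq_one hg n, mul_one] at h

include hg hu hlim in
/-- **Polar terms pass to the limit**: `M_{Fₙ}(s) → M_F(s)` for every `s` (dominated convergence on
`[-2a, 2a]`). [folklore] -/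
theorem tendsto_weilMellin_autocorr (s : ℂ) :
    Tendsto (fun n => weilMellin (autocorr (g n)) s) atTop (𝓝 (weilMellin (autocorr u) s)) := by
  have hcont : ∀ n, Continuous (autocorr (g n)) := fun n => by
    rw [autocorr_eq_weilConv]; exact ((hg n).1.weilConv (hg n).1.weilReflect).1.continuous
  have hker : Continuous fun x : ℝ => cexp ((s - 1 / 2) * x) := by fun_prop
  set B : ℝ := Real.exp (‖s - 1 / 2‖ * (2 * a)) with hB
  unfold weilMellin
  refine tendsto_integral_of_dominated_convergence (fun x => (Icc (-(2 * a)) (2 * a)).indicator (fun _ => B) x)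
    (fun n => ((hcont n).mul hker).aestronglyMeasurable) ?_ (fun n => Eventually.of_forall fun x => ?_)
    (Eventually.of_forall fun x => ?_)
  · exact (integrableOn_const measure_Icc_lt_top.ne).integrable_indicator measurableSet_Icc
  · by_cases hx : x ∈ Icc (-(2 * a)) (2 * a)
    · rw [indicator_of_mem hx, norm_mul, Complex.norm_exp]
      have hexp : Real.exp ((s - 1 / 2) * (x : ℂ)).re ≤ B := by
        refine Real.exp_le_exp.mpr ?_
        calc ((s - 1 / 2) * (x : ℂ)).re ≤ ‖(s - 1 / 2) * (x : ℂ)‖ := re_le_norm _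
          _ = ‖s - 1 / 2‖ * |x| := by rw [norm_mul, norm_real, Real.norm_eq_abs]
          _ ≤ ‖s - 1 / 2‖ * (2 * a) := mul_le_mul_of_nonneg_left (abs_le.mpr ⟨hx.1, hx.2⟩) (norm_nonneg _)
      calc ‖autocorr (g n) x‖ * Real.exp ((s - 1 / 2) * (x : ℂ)).re ≤ 1 * B :=
            mul_le_mul (norm_autocorr_test_le_one hg n x) hexp (Real.exp_nonneg _) zero_le_one
        _ = B := one_mul B
    · have hx' : 2 * a < |x| := by
        rcases not_and_or.mp (fun h => hx ⟨h.1, h.2⟩) with h | h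
        · have := not_le.mp h; rw [lt_abs]; right; linarith
        · have := not_le.mp h; rw [lt_abs]; left; linarith
      have h0 : autocorr (g n) x = 0 := autocorr_eq_zero_of_lt (support_subset_of_test hg n) hx'
      rw [indicator_of_notMem hx, h0, zero_mul, norm_zero]
  · exact (tendsto_autocorr (memLp_two_of_test hg) hu hlim x).mul tendsto_const_nhds

include hg hu hlim in
/-- `Re (u ⋆ ũ)(0) = ∫|u|² = 1`. [folklore] -/
theorem autocorr_limit_zero_re : (autocorr u 0).re = 1 := by
  rw [autocorr_zero_re, integral_norm_sq_eq_one_of_tendsto (memLp_two_of_test hg) (fun n => (hg n).2.2) hu hlim]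

/-! ## Fatou for the archimedean integrals -/

include ha hg hu hsu hlim in
/-- **Fatou step.**  With `ρ = reDigammaQuarter`, `ρ₀ = ρ 0`: if `∫ |ĝₙ(1/2+it)|² ρ(t) dt → AL` then
`t ↦ |û(1/2+it)|² ρ(t)` is integrable and `∫ |û(1/2+it)|² ρ ≤ AL`. [folklore] -/
theorem arch_fatou {AL : ℝ}
    (hA : Tendsto (fun n => ∫ t : ℝ, ‖weilMellin (g n) (1 / 2 + t * I)‖ ^ 2 * reDigammaQuarter t) atTop (𝓝 AL)) :
    Integrable (fun t : ℝ => ‖weilMellin u (1 / 2 + t * I)‖ ^ 2 * reDigammaQuarter t) ∧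
      ∫ t : ℝ, ‖weilMellin u (1 / 2 + t * I)‖ ^ 2 * reDigammaQuarter t ≤ AL := by
  set ρ : ℝ → ℝ := reDigammaQuarter with hρ
  set ρ₀ : ℝ := reDigammaQuarter 0 with hρ₀
  set G : ℕ → ℝ → ℝ := fun n t => ‖weilMellin (g n) (1 / 2 + t * I)‖ ^ 2 with hG
  set U : ℝ → ℝ := fun t => ‖weilMellin u (1 / 2 + t * I)‖ ^ 2 with hU
  have hρge : ∀ t, ρ₀ ≤ ρ t := fun t => reDigammaQuarter_zero_le t
  have hui : Integrable u := integrable_of_memLp_two_of_support hu hsu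
  have hn1 : ∫ t, ‖u t‖ ^ 2 = 1 := integral_norm_sq_eq_one_of_tendsto (memLp_two_of_test hg) (fun n => (hg n).2.2) hu hlim
  -- Plancherel
  have hPg : ∀ n, ∫ t, G n t = 2 * Real.pi := fun n => by
    simp only [hG]; rw [integral_norm_sq_weilMellin_half_line (hg n).1, weilNorm2Sq, (hg n).2.2, mul_one]
  have hPu : ∫ t, U t = 2 * Real.pi := by
    simp only [hU]; rw [integral_norm_sq_weilMellin_half_of_memLp hui hu, hn1, mul_one]
  -- integrability of `U` (Plancherel membership, change of variables `t ↦ -t/2π`)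
  have hFc : Continuous (𝓕 u) :=
    VectorFourier.fourierIntegral_continuous Real.continuous_fourierChar (by exact continuous_inner) hui
  have hUcont : Continuous U := by
    have h1 : Continuous fun t : ℝ => ‖𝓕 u (-t / (2 * Real.pi))‖ ^ 2 :=
      ((hFc.comp (by fun_prop : Continuous fun t : ℝ => -t / (2 * Real.pi))).norm).pow 2
    refine h1.congr fun t => ?_
    simp only [hU]
    rw [weilMellin_half_eq_fourier]
  have hUint : Integrable U := by
    have hF2 := Literature.Analysis.FunctionSpaces.memLp_two_fourierIntegral hui hu
    have h1 : Integrable (fun ξ : ℝ => ‖𝓕 u ξ‖ ^ 2) := (memLp_two_iff_integrable_sq_norm hF2.1).mp hF2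
    have h2 := h1.comp_mul_left' (R := -(1 / (2 * Real.pi))) (neg_ne_zero.mpr (by positivity))
    refine h2.congr (Eventually.of_forall fun t => ?_)
    simp only [hU]
    rw [weilMellin_half_eq_fourier, show -(1 / (2 * Real.pi)) * t = -t / (2 * Real.pi) by ring]
  -- integrability of `G n · ρ` and `G n`
  have hGρ : ∀ n, Integrable (fun t => G n t * ρ t) := fun n => integrable_norm_sq_weilMellin_mul_reDigammaQuarter (hg n).1
  have hGi : ∀ n, Integrable (G n) := fun n => integrable_norm_sq_weilMellin_half_line (hg n).1
  -- the nonnegative functions `hₙ = Gₙ (ρ − ρ₀) → h = U (ρ − ρ₀)` pointwise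
  have hpt : ∀ t, Tendsto (fun n => G n t * (ρ t - ρ₀)) atTop (𝓝 (U t * (ρ t - ρ₀))) := by
    intro t
    have h := (tendsto_weilMellin_half ha.le (memLp_two_of_test hg) (support_subset_of_test hg) hu hsu hlim t).norm
    exact (h.pow 2).mul tendsto_const_nhds
  have hint_h : ∀ n, ∫ t, G n t * (ρ t - ρ₀) = (∫ t, G n t * ρ t) - ρ₀ * (2 * Real.pi) := by
    intro n
    have e : (fun t => G n t * (ρ t - ρ₀)) = fun t => G n t * ρ t - ρ₀ * G n t := by funext t; ring
    rw [e, integral_sub (hGρ n) ((hGi n).const_mul ρ₀), integral_const_mul, hPg n]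
  have hlimh : Tendsto (fun n => ∫ t, G n t * (ρ t - ρ₀)) atTop (𝓝 (AL - ρ₀ * (2 * Real.pi))) := by
    simp_rw [hint_h]; exact hA.sub tendsto_const_nhds
  -- Fatou in `ℝ≥0∞`
  have hmeas : ∀ n, AEMeasurable (fun t => ENNReal.ofReal (G n t * (ρ t - ρ₀))) volume := fun n =>
    (((continuous_norm_sq_weilMellin_half_line (hg n).1).mul
      (continuous_reDigammaQuarter.sub continuous_const)).measurable.ennreal_ofReal).aemeasurable
  have hF := lintegral_liminf_le' (μ := volume) (u := atTop) hmeas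
  have hliminf_pt : ∀ t, liminf (fun n => ENNReal.ofReal (G n t * (ρ t - ρ₀))) atTop =
      ENNReal.ofReal (U t * (ρ t - ρ₀)) := fun t => (ENNReal.tendsto_ofReal (hpt t)).liminf_eq
  have hliminf_int : liminf (fun n => ∫⁻ t, ENNReal.ofReal (G n t * (ρ t - ρ₀))) atTop =
      ENNReal.ofReal (AL - ρ₀ * (2 * Real.pi)) := by
    have e : ∀ n, ∫⁻ t, ENNReal.ofReal (G n t * (ρ t - ρ₀)) = ENNReal.ofReal (∫ t, G n t * (ρ t - ρ₀)) := by
      intro n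
      rw [ofReal_integral_eq_lintegral_ofReal]
      · have e : (fun t => G n t * (ρ t - ρ₀)) = fun t => G n t * ρ t - ρ₀ * G n t := by funext t; ring
        rw [e]; exact (hGρ n).sub ((hGi n).const_mul ρ₀)
      · exact Eventually.of_forall fun t => mul_nonneg (by positivity) (sub_nonneg.mpr (hρge t))
    simp_rw [e]
    exact (ENNReal.tendsto_ofReal hlimh).liminf_eq
  simp_rw [hliminf_pt] at hF
  rw [hliminf_int] at hF
  -- so `h = U (ρ − ρ₀)` is integrable with integral `≤ AL − 2πρ₀`
  have hh_nn : 0 ≤ᵐ[volume] fun t => U t * (ρ t - ρ₀) :=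
    Eventually.of_forall fun t => mul_nonneg (by positivity) (sub_nonneg.mpr (hρge t))
  have hh_meas : AEStronglyMeasurable (fun t => U t * (ρ t - ρ₀)) volume :=
    (hUcont.mul (continuous_reDigammaQuarter.sub continuous_const)).aestronglyMeasurable
  have hh_int : Integrable (fun t => U t * (ρ t - ρ₀)) :=
    ⟨hh_meas, (hasFiniteIntegral_iff_ofReal hh_nn).mpr (lt_of_le_of_lt hF ENNReal.ofReal_lt_top)⟩
  have hh_le : ∫ t, U t * (ρ t - ρ₀) ≤ AL - ρ₀ * (2 * Real.pi) := by
    rw [integral_eq_lintegral_of_nonneg_ae hh_nn hh_meas]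
    refine ENNReal.toReal_le_of_le_ofReal ?_ hF
    -- `AL − 2πρ₀ ≥ 0`: limit of nonnegative numbers
    refine ge_of_tendsto' hlimh fun n => integral_nonneg fun t => ?_
    exact mul_nonneg (by positivity) (sub_nonneg.mpr (hρge t))
  -- back to `U ρ = h + ρ₀ U`
  have e : (fun t => U t * ρ t) = fun t => U t * (ρ t - ρ₀) + ρ₀ * U t := by funext t; ring
  refine ⟨?_, ?_⟩
  · show Integrable (fun t => U t * ρ t); rw [e]; exact hh_int.add (hUint.const_mul ρ₀)
  · show ∫ t, U t * ρ t ≤ AL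
    rw [e, integral_add hh_int (hUint.const_mul ρ₀), integral_const_mul, hPu]
    linarith

/-! ## The package -/

include ha hg hu hsu hlim in
/-- **Lower semicontinuity package for the limit of a minimising sequence.**  If moreover
`reWar (gₙ ⋆ g̃ₙ) → V`, then `Re (u ⋆ ũ)(0) = 1`, the archimedean integrand of `u ⋆ ũ` is integrable, and
`reWar (u ⋆ ũ) ≤ V`. [folklore] -/
theorem lsc_package_of {V : ℝ} (hval : Tendsto (fun n => reWar (autocorr (g n))) atTop (𝓝 V)) :
    (autocorr u 0).re = 1 ∧ Integrable (archIntegrand (autocorr u)) volume ∧ reWar (autocorr u) ≤ V := by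
  have hui : Integrable u := integrable_of_memLp_two_of_support hu hsu
  have h0 : (autocorr u 0).re = 1 := autocorr_limit_zero_re hg hu hlim
  -- the values of the tests, decomposed
  have hdec : ∀ n, reWar (autocorr (g n)) =
      (weilMellin (autocorr (g n)) 0 + weilMellin (autocorr (g n)) 1).re +
        1 / (2 * Real.pi) * (∫ t : ℝ, ‖weilMellin (g n) (1 / 2 + t * I)‖ ^ 2 * reDigammaQuarter t) -
        1 * Real.log Real.pi := by
    intro n
    have hi : Integrable (g n) := (hg n).1.1.continuous.integrable_of_hasCompactSupport (hg n).1.2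
    rw [reWar_autocorr_eq hi, autocorr_zero_re, (hg n).2.2]
  -- polar limit
  set P : ℝ := (weilMellin (autocorr u) 0 + weilMellin (autocorr u) 1).re with hP
  have hpol : Tendsto (fun n => (weilMellin (autocorr (g n)) 0 + weilMellin (autocorr (g n)) 1).re) atTop (𝓝 P) :=
    (continuous_re.tendsto _).comp ((tendsto_weilMellin_autocorr hg hu hlim 0).add
      (tendsto_weilMellin_autocorr hg hu hlim 1))
  -- hence the archimedean integrals converge
  have harch : Tendsto (fun n => ∫ t : ℝ, ‖weilMellin (g n) (1 / 2 + t * I)‖ ^ 2 * reDigammaQuarter t) atTop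
      (𝓝 (2 * Real.pi * (V - P + Real.log Real.pi))) := by
    have e : ∀ n, (∫ t : ℝ, ‖weilMellin (g n) (1 / 2 + t * I)‖ ^ 2 * reDigammaQuarter t) =
        2 * Real.pi * (reWar (autocorr (g n)) - (weilMellin (autocorr (g n)) 0 + weilMellin (autocorr (g n)) 1).re
          + Real.log Real.pi) := by
      intro n
      set X : ℝ := ∫ t : ℝ, ‖weilMellin (g n) (1 / 2 + t * I)‖ ^ 2 * reDigammaQuarter t with hX
      rw [hdec n, ← hX]
      have hpi : (2 * Real.pi) ≠ 0 := by positivity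
      field_simp
      ring
    simp_rw [e]
    exact ((hval.sub hpol).add tendsto_const_nhds).const_mul _
  obtain ⟨hint, hle⟩ := arch_fatou ha hg hu hsu hlim harch
  refine ⟨h0, ?_, ?_⟩
  · -- `archIntegrand F t = ((U t ρ t : ℝ) : ℂ)`
    have e : archIntegrand (autocorr u) =
        fun t : ℝ => ((‖weilMellin u (1 / 2 + t * I)‖ ^ 2 * reDigammaQuarter t : ℝ) : ℂ) := by
      funext t
      simp only [archIntegrand, mellinShift_eq_weilMellin]
      rw [weilMellin_autocorr_half hui t]
      unfold reDigammaQuarter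
      push_cast; ring
    rw [e]
    exact hint.ofReal
  · rw [reWar_autocorr_eq hui, h0, ← hP]
    have hpi : 0 < 2 * Real.pi := by positivity
    have : 1 / (2 * Real.pi) * (∫ t : ℝ, ‖weilMellin u (1 / 2 + t * I)‖ ^ 2 * reDigammaQuarter t) ≤
        V - P + Real.log Real.pi := by
      rw [div_mul_eq_mul_div, one_mul, div_le_iff₀ hpi]
      linarith
    linarith

end Setting

/-- **Lower semicontinuity package** (registered stub `lsc_package` of stmt-RiemannHypothesis-16302; the `∀`-form of
`lsc_package_of`). [folklore] -/
theorem lsc_package : ∀ {a : ℝ} {u : ℝ → ℂ} {g : ℕ → ℝ → ℂ}, 0 < a → (∀ n, IsWeilTest (g n) ∧ tsupport (g n) ⊆ Icc (-a) a ∧ ∫ t, ‖g n t‖ ^ 2 = 1) → MemLp u 2 volume → Function.support u ⊆ Icc (-a) a → Tendsto (fun n => ∫ x, ‖g n x - u x‖ ^ 2) atTop (𝓝 0) → ∀ {V : ℝ}, Tendsto (fun n => reWar (autocorr (g n))) atTop (𝓝 V) → (autocorr u 0).re = 1 ∧ Integrable (archIntegrand (autocorr u)) volume ∧ reWar (autocorr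 u) ≤ V :=
  fun ha hg hu hsu hlim _ hval => lsc_package_of ha hg hu hsu hlim hval

end Summit.RiemannHypothesis.RiemannHypothesis.Theorems.SignCone.DualWitness

end
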